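import Summits.AtomisticToContinuum.FouriersLaw.Theses.PhononMeanFreePath
import Summits.AtomisticToContinuum.FouriersLaw.Theses.StaticAbelianSqueeze
import Summits.AtomisticToContinuum.FouriersLaw.Theses.OddSectorIrreversibility

/-!
# Sketch — crux ideas on `WitnessGlue` (stmt-AtomisticToContinuum-15120), round 1, ideator 1

Card `tap-form-cauchy-schwarz` (open-semigroup leak plumbing):
* `tapForm`, `TapFormLeakBound` (FIRST LEMMA, fixed `N`), `LeakDerivativeIdentity`, `DissipationIdentity`
  (the two exact fixed-`N` identities it rests on),
* `OpenConeRetention` (E3′: norm retention of the open-evolved bond current = replica overlap),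
  `OpenClosedInfluenceCone` (E3*: mean-square open-vs-closed influence cone; implies E3′ and converts the typed
  closed `SubBallisticWindow` into its open forecast form), `SubBallisticWindowOpen`,
* `WitnessGlueOpen`, `WitnessGlueAllOpen` (the two co-restatement shapes of the crux),
* `abs_bilin_le` — the lever's core, PROVED: Cauchy–Schwarz for a nonnegative symmetric bilinear form.
Card `boundary-kubo-import`: `GibbsDetailedBalance` (S2), `BulkBoundaryGreenKubo` (KDN bulk↔boundary identity),
  `ConjunctBOfBoundaryKubo` (transfer shape).
Definitions + one elementary theorem; no `sorry`.
-/

noncomputable section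

open MeasureTheory Filter Set
open scoped BigOperators NNReal

namespace Summit.AtomisticToContinuum.FouriersLaw.Cruxes.WitnessGlue.Ideator1

open Literature.MathematicalPhysics.KineticTheory.HeatConduction
open Summit.AtomisticToContinuum.FouriersLaw.Theses.OddSectorIrreversibility

/-! ### The lever, abstractly: Cauchy–Schwarz in a nonnegative symmetric bilinear form (PROVED) -/

/-- Cauchy–Schwarz for a nonnegative symmetric bilinear form `q` on a real vector space:
`|q f g| ≤ √(q f f) · √(q g g)`. Applied with `q` = the tap Dirichlet form
`γT Σ_b ⟨∂_{p_b}f, ∂_{p_b}g⟩_{μ_T}`, `f = u` (Kubo corrector: `q u u = ⟨u, J⟩` exactly) and `g = P_s j_i`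
(`∫₀ᵗ q g_s g_s ds = ½(‖j_i‖² − ‖P_t j_i‖²)` exactly). [folklore] -/
theorem abs_bilin_le {V : Type*} [AddCommGroup V] [Module ℝ V] (q : V →ₗ[ℝ] V →ₗ[ℝ] ℝ)
    (hsymm : ∀ f g, q f g = q g f) (hpos : ∀ f, 0 ≤ q f f) (f g : V) :
    |q f g| ≤ Real.sqrt (q f f) * Real.sqrt (q g g) := by
  have key : ∀ r : ℝ, 0 ≤ q g g * (r * r) + (2 * q f g) * r + q f f := by
    intro r
    have h := hpos (f + r • g)
    have e : q (f + r • g) (f + r • g) = q f f + 2 * r * q f g + r * r * q g g := by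
      simp only [map_add, map_smul, LinearMap.add_apply, LinearMap.smul_apply, smul_eq_mul, hsymm g f]
      ring
    rw [e] at h
    nlinarith [h]
  have hd : discrim (q g g) (2 * q f g) (q f f) ≤ 0 := discrim_le_zero key
  unfold discrim at hd
  have hsq : (q f g) ^ 2 ≤ q f f * q g g := by nlinarith [hd]
  calc |q f g| ≤ Real.sqrt (q f f * q g g) := Real.abs_le_sqrt hsq
    _ = Real.sqrt (q f f) * Real.sqrt (q g g) := Real.sqrt_mul (hpos f) _

/-! ### Card `tap-form-cauchy-schwarz` — fixed-`N` objects and the first lemma -/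

/-- The TAP DIRICHLET FORM of the equilibrium chain against the unnormalised Gibbs weight `μ_T = e^{−H/T}dqdp`:
`q(f,g) = γT·Σ_b ([b=0] + [b=N−1]) ∫ ∂_{p_b}f ∂_{p_b}g dμ_T` (double tap at `N = 1`, matching the generator).
`q(f,f) = −⟨L_{T,T} f, f⟩_{μ_T}` for classical `f` (Liouville part antisymmetric). -/
def tapForm (ω₂ lam β γ T : ℝ) (N : ℕ) (f g : PhaseSpace N → ℝ) : ℝ :=
  let P := pinnedChain ω₂ lam β γ
  let μT : Measure (PhaseSpace N) :=
    volume.withDensity (fun x : PhaseSpace N => ENNReal.ofReal (Real.exp (-(P.hamiltonian N x) / T)))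
  γ * T * ∑ b : Fin N,
    ((if b.val = 0 then ∫ x, partialP b f x * partialP b g x ∂μT else 0) +
      (if b.val = N - 1 then ∫ x, partialP b f x * partialP b g x ∂μT else 0))

/-- **FIRST LEMMA (fixed `N`; the card's lever in the route's vocabulary).** For a classical solution
`u ∈ C² ∩ L²(μ_T)` of `L_{T,T} u = −J` with tap derivatives in `L²(μ_T)` (all LANDED for the Kubo corrector:
`CorrectorTheorySmooth`, `CorrectorTheoryEnergy`), the pairing of its odd part `u⁻` with the OPEN equilibrium
forecast `P_t j_i` of one bond current leaves the plateau `⟨u, j_i⟩_{μ_T}` only through the tap form, and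
Cauchy–Schwarz IN THE FORM gives
`|⟨u⁻, P_t j_i⟩ − ⟨u, j_i⟩| ≤ √⟨u, J⟩ · √t · √(½(‖j_i‖² − ‖P_t j_i‖²))`
(tap identity `q(u,u) = ⟨u,J⟩`; dissipation identity `∫₀ᵗ q(P_s j_i) ds = ½(‖j_i‖² − ‖P_t j_i‖²)`).
No closed flow, no tangent dynamics, no kick. -/
def TapFormLeakBound : Prop :=
  ∀ ω₂ lam β γ : ℝ, 0 < ω₂ → 0 < lam → 0 < β → 0 < γ → ∀ T : ℝ, 0 < T →
    ∀ (N : ℕ) (i : Fin N) (t : ℝ), 0 ≤ t → ∀ u : PhaseSpace N → ℝ,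
      let P := pinnedChain ω₂ lam β γ
      let μT : Measure (PhaseSpace N) :=
        volume.withDensity (fun x : PhaseSpace N => ENNReal.ofReal (Real.exp (-(P.hamiltonian N x) / T)))
      let J : PhaseSpace N → ℝ := fun z => ∑ k : Fin N, P.bondCurrent N k z
      let jt : PhaseSpace N → ℝ := fun x => ∫ y, P.bondCurrent N i y ∂(P.transitionKernel N T T t.toNNReal x)
      let uo : PhaseSpace N → ℝ := fun x => (u x - u (x.1, -x.2)) / 2
      ContDiff ℝ 2 u → MemLp u 2 μT → (∀ x, P.generator N T T u x = -J x) →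
      (∀ b : Fin N, (b.val = 0 ∨ b.val = N - 1) → MemLp (partialP b u) 2 μT) →
        |(∫ x, uo x * jt x ∂μT) - ∫ x, u x * P.bondCurrent N i x ∂μT|
          ≤ Real.sqrt (∫ x, u x * J x ∂μT) * Real.sqrt t *
              Real.sqrt (((∫ x, (P.bondCurrent N i x) ^ 2 ∂μT) - ∫ x, (jt x) ^ 2 ∂μT) / 2)

/-- Exact identity 1 (fixed `N`): the leak RATE is minus the tap form between the FULL corrector and the
open forecast, `d/ds ⟨u⁻, P_s j_i⟩ = −q(u, P_s j_i)` — stated in integrated form. Parity split of `Lu = −J`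
(even part `A u⁻ = −S u⁺`), antisymmetry of the Liouville part, Gaussian IBP in `p_b`; the `S`-part of `L`
acting on `P_s j_i` contributes `∂_b u⁻`, the `A`-part `∂_b u⁺`, total `∂_b u`. -/
def LeakDerivativeIdentity : Prop :=
  ∀ ω₂ lam β γ : ℝ, 0 < ω₂ → 0 < lam → 0 < β → 0 < γ → ∀ T : ℝ, 0 < T →
    ∀ (N : ℕ) (i : Fin N) (t : ℝ), 0 ≤ t → ∀ u : PhaseSpace N → ℝ,
      let P := pinnedChain ω₂ lam β γ
      let μT : Measure (PhaseSpace N) :=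
        volume.withDensity (fun x : PhaseSpace N => ENNReal.ofReal (Real.exp (-(P.hamiltonian N x) / T)))
      let J : PhaseSpace N → ℝ := fun z => ∑ k : Fin N, P.bondCurrent N k z
      let js : ℝ → PhaseSpace N → ℝ := fun s x => ∫ y, P.bondCurrent N i y ∂(P.transitionKernel N T T s.toNNReal x)
      let uo : PhaseSpace N → ℝ := fun x => (u x - u (x.1, -x.2)) / 2
      ContDiff ℝ 2 u → MemLp u 2 μT → (∀ x, P.generator N T T u x = -J x) →
      (∀ b : Fin N, (b.val = 0 ∨ b.val = N - 1) → MemLp (partialP b u) 2 μT) →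
        (∫ x, uo x * js t x ∂μT) - (∫ x, u x * P.bondCurrent N i x ∂μT)
          = -∫ s in Set.Ioc (0 : ℝ) t, tapForm ω₂ lam β γ T N u (js s)

/-- Exact identity 2 (fixed `N`): the `L²(μ_T)` DISSIPATION IDENTITY for one bond current under the open
equilibrium semigroup, `‖j_i‖² − ‖P_t j_i‖² = 2∫₀ᵗ q(P_s j_i, P_s j_i) ds` (Gibbs invariance of the kernels;
the Liouville part is antisymmetric, only the two taps dissipate) — the bond-resolved form of MEMORY (5) of
`Literature.MathematicalPhysics.KineticTheory.OddSectorLocalityHypothesis`. -/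
def DissipationIdentity : Prop :=
  ∀ ω₂ lam β γ : ℝ, 0 < ω₂ → 0 < lam → 0 < β → 0 < γ → ∀ T : ℝ, 0 < T →
    ∀ (N : ℕ) (i : Fin N) (t : ℝ), 0 ≤ t →
      let P := pinnedChain ω₂ lam β γ
      let μT : Measure (PhaseSpace N) :=
        volume.withDensity (fun x : PhaseSpace N => ENNReal.ofReal (Real.exp (-(P.hamiltonian N x) / T)))
      let js : ℝ → PhaseSpace N → ℝ := fun s x => ∫ y, P.bondCurrent N i y ∂(P.transitionKernel N T T s.toNNReal x)
      (∫ x, (P.bondCurrent N i x) ^ 2 ∂μT) - (∫ x, (js t x) ^ 2 ∂μT)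
        = 2 * ∫ s in Set.Ioc (0 : ℝ) t, tapForm ω₂ lam β γ T N (js s) (js s)

/-! ### Card `tap-form-cauchy-schwarz` — the co-restated causality antecedents (N-uniform) -/

/-- **E3′ `OpenConeRetention`** (norm retention of the open-evolved bond current inside a linear cone,
polynomial tail, exponent fixed to `3`): with `d = min(i, N−2−i)` the distance of bond `i` to the nearer contact,
`‖j_i‖²_{μ_T} − ‖P_t j_i‖²_{μ_T} ≤ C (1 + (d − t/a))^{−3} · Z_N` for `t ≤ a d`.
Replica form: `= ½ E|j_i(X_t) − j_i(X′_t)|²` for two open replicas from one Gibbs point (the route's kit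
estimator); a priori `≤ ‖j_i‖²` (bounded gain, no kick size `s`). The leak bookkeeping closes for any tail
exponent `m ≥ 2`; `3` is filed for slack (and for the E2 conversion of `OpenClosedInfluenceCone`, which needs `m > 2`). -/
def OpenConeRetention : Prop :=
  ∀ ω₂ lam β γ : ℝ, 0 < ω₂ → 0 < lam → 0 < β → 0 < γ → ∀ T : ℝ, 0 < T →
    ∃ a C : ℝ, 0 < a ∧ ∀ (N : ℕ) (i : Fin N) (t : ℝ), 0 ≤ t →
      let P := pinnedChain ω₂ lam β γ
      let μT : Measure (PhaseSpace N) :=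
        volume.withDensity (fun x : PhaseSpace N => ENNReal.ofReal (Real.exp (-(P.hamiltonian N x) / T)))
      let d : ℕ := min i.val (N - 2 - i.val)
      let jt : PhaseSpace N → ℝ := fun x => ∫ y, P.bondCurrent N i y ∂(P.transitionKernel N T T t.toNNReal x)
      t ≤ a * (d : ℝ) →
        (∫ x, (P.bondCurrent N i x) ^ 2 ∂μT) - (∫ x, (jt x) ^ 2 ∂μT)
          ≤ C * (1 + ((d : ℝ) - t / a)) ^ (-(3 : ℝ)) * ∫ x, Real.exp (-(P.hamiltonian N x) / T) ∂volume

/-- **E3* `OpenClosedInfluenceCone`** (mean-square influence of the boundary noise + friction on a bulk bond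
current: open process versus closed flow from the SAME Gibbs point):
`∫∫ (j_i(y) − j_i(Φ_t x))² P_t(x,dy) dμ_T(x) ≤ C (1 + (d − t/a))^{−3} · Z_N` for `t ≤ a d`, `d = min(i, N−2−i)`,
`Φ_t` = the zero-friction kernels. Implies E3′ (conditional variance ≤ mean-square error of the
`X_0`-measurable predictor `j_i∘Φ_t`) and converts the typed CLOSED `SubBallisticWindow` into its open
forecast form by Minkowski. Finite perturbation, bounded gain (`≤ 4‖j_i‖²`), no `s → 0`. -/
def OpenClosedInfluenceCone : Prop :=
  ∀ ω₂ lam β γ : ℝ, 0 < ω₂ → 0 < lam → 0 < β → 0 < γ → ∀ T : ℝ, 0 < T →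
    ∃ a C : ℝ, 0 < a ∧ ∀ (N : ℕ) (i : Fin N) (t : ℝ), 0 ≤ t →
      let P := pinnedChain ω₂ lam β γ
      let P₀ := pinnedChain ω₂ lam β 0
      let μT : Measure (PhaseSpace N) :=
        volume.withDensity (fun x : PhaseSpace N => ENNReal.ofReal (Real.exp (-(P.hamiltonian N x) / T)))
      let d : ℕ := min i.val (N - 2 - i.val)
      let jt₀ : PhaseSpace N → ℝ := fun x => ∫ y, P.bondCurrent N i y ∂(P₀.transitionKernel N T T t.toNNReal x)
      t ≤ a * (d : ℝ) →
        ∫ x, (∫ y, (P.bondCurrent N i y - jt₀ x) ^ 2 ∂(P.transitionKernel N T T t.toNNReal x)) ∂μT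
          ≤ C * (1 + ((d : ℝ) - t / a)) ^ (-(3 : ℝ)) * ∫ x, Real.exp (-(P.hamiltonian N x) / T) ∂volume

/-- Open-forecast form of E2 (all-open variant only): the typed `SubBallisticWindow` with the equilibrium
OPEN kernels `P_t` in place of the closed flow — `‖∫₀^τ P_t J_B dt‖²_{μ_T} ≤ C(1+τ)|B|·Z_N`; weaker than the
path-space (Einstein–Helfand) variance of the open chain by conditional Jensen. -/
def SubBallisticWindowOpen : Prop :=
  ∀ ω₂ lam β γ : ℝ, 0 < ω₂ → 0 < lam → 0 < β → 0 < γ → ∀ T : ℝ, 0 < T → ∃ C : ℝ,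
    ∀ (N k₁ k₂ : ℕ), k₁ ≤ k₂ → k₂ + 1 ≤ N → ∀ τ : ℝ, 0 ≤ τ →
      let P := pinnedChain ω₂ lam β γ
      let μT : Measure (PhaseSpace N) :=
        volume.withDensity (fun x : PhaseSpace N => ENNReal.ofReal (Real.exp (-(P.hamiltonian N x) / T)))
      let JB : PhaseSpace N → ℝ := fun z => ∑ i : Fin N, (if k₁ ≤ i.val ∧ i.val < k₂ then P.bondCurrent N i z else 0)
      ∫ x, (∫ t in Set.Ioc (0 : ℝ) τ, (∫ y, JB y ∂(P.transitionKernel N T T t.toNNReal x))) ^ 2 ∂μT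
        ≤ C * (1 + τ) * ((k₂ : ℝ) - k₁) * ∫ x, Real.exp (-(P.hamiltonian N x) / T) ∂volume

/-- **Co-restatement shape 1 (recommended; consumes the typed E1 and E2 VERBATIM):**
`OpenClosedInfluenceCone → ConeScaleCorrector → SubBallisticWindow → BoundedResponse`. -/
def WitnessGlueOpen : Prop :=
  OpenClosedInfluenceCone → ConeScaleCorrector → SubBallisticWindow → BoundedResponse

/-- **Co-restatement shape 2 (all-open; no closed flow anywhere in the glue):**
`OpenConeRetention → ConeScaleCorrector → SubBallisticWindowOpen → BoundedResponse`. -/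
def WitnessGlueAllOpen : Prop :=
  OpenConeRetention → ConeScaleCorrector → SubBallisticWindowOpen → BoundedResponse

/-! ### Card `boundary-kubo-import` — the one fixed-`N` lemma and the transfer shape -/

/-- **S2 `GibbsDetailedBalance`** (Θ-detailed balance of the equilibrium kernels on `L²(μ_T)`, weak form on a
product of two polynomially bounded continuous observables; the `gibbsMeasure` form with `e^{ϑH}` bounds is LANDED as
`HonestZwanzig.pinnedChain_integral_mul_act_flip` — this decl only fixes the card's notation): `⟨f, P_t g⟩_{μ_T} = ⟨(P_t (f∘Θ))∘Θ, g⟩_{μ_T}`,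
`Θ(q,p) = (q,−p)` — the time reversal of the STATIONARY chain is its momentum flip (Haussmann–Pardoux reversed
drift `−b + ρ⁻¹∇·(ρa)` flips exactly the friction sign; Kundu–Dhar–Narayan (reln2)). Stated for continuous
`f, g` with `|f|,|g| ≤ K(1+H)^k`. -/
def GibbsDetailedBalance : Prop :=
  ∀ ω₂ lam β γ : ℝ, 0 < ω₂ → 0 < lam → 0 < β → 0 < γ → ∀ T : ℝ, 0 < T →
    ∀ (N : ℕ) (t : ℝ), 0 ≤ t → ∀ (f g : PhaseSpace N → ℝ) (K : ℝ) (k : ℕ),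
      let P := pinnedChain ω₂ lam β γ
      let μT : Measure (PhaseSpace N) :=
        volume.withDensity (fun x : PhaseSpace N => ENNReal.ofReal (Real.exp (-(P.hamiltonian N x) / T)))
      Continuous f → Continuous g →
      (∀ x, |f x| ≤ K * (1 + P.hamiltonian N x) ^ k) → (∀ x, |g x| ≤ K * (1 + P.hamiltonian N x) ^ k) →
        ∫ x, f x * (∫ y, g y ∂(P.transitionKernel N T T t.toNNReal x)) ∂μT
          = ∫ x, (∫ y, f (y.1, -y.2) ∂(P.transitionKernel N T T t.toNNReal (x.1, -x.2))) * g x ∂μT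

/-- **`BulkBoundaryGreenKubo`** (fixed `N ≥ 2`, pure equilibrium identity; KDN (reln1) = (reln3)): the bulk
Green–Kubo integral of the total current equals the boundary cross-Kubo integral,
`∫₀^∞ ⟨J, P_tJ⟩_π dt = (N−1)² γ² ∫₀^∞ Cov_π(p_0², P_t p_{N−1}²) dt`, both integrands integrable
(two Dynkin identities `L(Σ k e_k) = J + (N−1)w_R`, `LH = w_L + w_R`, ONE use of S2, parity, CEHR decay). -/
def BulkBoundaryGreenKubo : Prop :=
  ∀ ω₂ lam β γ : ℝ, 0 < ω₂ → 0 < lam → 0 < β → 0 < γ → ∀ T : ℝ, 0 < T → ∀ N : ℕ, 2 ≤ N →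
    ∀ b₀ b₁ : Fin N, b₀.val = 0 → b₁.val = N - 1 →
      let P := pinnedChain ω₂ lam β γ
      let π : Measure (PhaseSpace N) := P.gibbsMeasure N T
      let J : PhaseSpace N → ℝ := fun z => ∑ k : Fin N, P.bondCurrent N k z
      let cJ : ℝ → ℝ := fun t => ∫ z, J z * (∫ y, J y ∂(P.transitionKernel N T T t.toNNReal z)) ∂π
      let cB : ℝ → ℝ := fun t =>
        (∫ z, (z.2 b₀) ^ 2 * (∫ y, (y.2 b₁) ^ 2 ∂(P.transitionKernel N T T t.toNNReal z)) ∂π) -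
          (∫ z, (z.2 b₀) ^ 2 ∂π) * (∫ z, (z.2 b₁) ^ 2 ∂π)
      IntegrableOn cJ (Set.Ioi 0) ∧ IntegrableOn cB (Set.Ioi 0) ∧
        ∫ t in Set.Ioi (0 : ℝ), cJ t = ((N : ℝ) - 1) ^ 2 * γ ^ 2 * ∫ t in Set.Ioi (0 : ℝ), cB t

/-- **Transfer shape of card `boundary-kubo-import`:** conjunct B of `CorrectorTheory` (= the crux
`StaticAbelianSqueeze.KuboAbelIdentity`, stmt-13419) follows from the staffed crux
`PhononMeanFreePath.BoundaryKubo` (stmt-11812) and the fixed-`N` equilibrium identity `BulkBoundaryGreenKubo`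
(itself: two Dynkin identities + `GibbsDetailedBalance`). -/
def ConjunctBOfBoundaryKubo : Prop :=
  Summit.AtomisticToContinuum.FouriersLaw.Theses.PhononMeanFreePath.BoundaryKubo →
    BulkBoundaryGreenKubo →
      Summit.AtomisticToContinuum.FouriersLaw.Theses.StaticAbelianSqueeze.KuboAbelIdentity

end Summit.AtomisticToContinuum.FouriersLaw.Cruxes.WitnessGlue.Ideator1

end
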